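import Mathlib.FieldTheory.IsAlgClosed.AlgebraicClosure
import Literature.AnabelianGeometry.AbsoluteAnabelian.FreeProfiniteCommutatorCusp
import Literature.AnabelianGeometry.AbsoluteAnabelian.FreeProSigmaNonVacuity
import Literature.AnabelianGeometry.AbsoluteAnabelian.AbsTopILem45iModelProofs
import Literature.AnabelianGeometry.AbsoluteAnabelian.AbsTopIII.CcnTransgressionFreeGeom
import Literature.AnabelianGeometry.AbsoluteAnabelian.AbsTopIII.CurveModelProp14iiReduction
import Literature.GroupTheory.ProfiniteSubquotients
import HarnessLib

/-!
# [AbsTopIII] §1: the once-punctured torus as a NAMED carrier of `CurveModel`; the Prop. 1.4 package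
# (F-0338 · F-0339 · F-0340 · F-0341 · F-0365) at it, in instance form

S. Mochizuki, *Topics in Absolute Anabelian Geometry III* [AbsTopIII] (bib `MochizukiAbsTopIII2015`;
kurims manuscript `paper:url-5493eb38cbb7`), §1, Prop. 1.4 (i)/(ii) p. 31 ("`I_x` [...] is naturally
isomorphic to `Ẑ(1)`"; "`1 → I_x → Δ^{c-cn}_{U_x} → Δ_X → 1`"; "`M_X := Hom(H²(Δ_X, Ẑ), Ẑ)` [...] the
natural isomorphism `M_X ⥲ I_x`").  Cell abc-iut, block F, seat abc-iut-f-071 gen 5, KEY «INST59G1»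
(FACT-LIST F-0338 `CurveModel.Prop_1_4_ii_transgression`, F-0365 `CurveModel.Prop_1_4_ii_sync`).

These `CurveModel`-relative rows are SCHEMAS (universal closures refuted, `not_forall_prop_1_4_ii_sync`
etc.).  abc-iut-f-076 exhibited a NON-DEGENERATE model at which the whole Prop. 1.4 package holds —
the once-punctured torus, profinitely — but only INSIDE `∃`-proofs
(`CurveModel.exists_isCyclotomePresentation_oncePuncturedTorus`, `…exists_oncePuncturedTorus_prop_1_4`:
the model is a `let`, invisible to importers and to the kernel census of instance forms), while at the
tree's NAMED toy carriers (`CurveModelSchemaWitness.toyModel k H`) F-0338/F-0365 are vacuous (no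
cyclotome presentation) or false (`H = Ẑ`: `Hom(H²(Ẑ, Ẑ), Ẑ) = 0 ≠ I_x`).  THIS FILE NAMES f-076's
CARRIER as definitions (proofs re-run against the names; credit f-076, nothing of theirs edited):
`freeTwo = F̂₂ = ⟨a, b⟩^`, `comm = [a, b]`, `inertia = ⟨[a,b]⟩⁻ ≅ Ẑ`, `cuspKernel = ⟨⟨[a,b]⟩⟩⁻`,
`piX = F̂₂/⟨⟨[a,b]⟩⟩⁻`, `extU = (F̂₂ ↠ G_{ℚ̄} = 1)`, `extX`, `resHom` (quotient map), `cuspsU` (one cusp,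
`D_x = I_x`), `cuspsX` (none), **`OncePuncturedTorusCarrier.model : CurveModel.{0}`**; proves
`isCyclotomePresentation`, `geom_extX_ne_bot` (`Δ_X ≠ 1`) and the five rows AT `model` — INSTANCE FORMS
(0 hypotheses, conclusion head = the decl): `prop_1_4_i` (F-0339), `prop_1_4_i'` (F-0340), `prop_1_4_ii`
(F-0341), `prop_1_4_ii_transgression` (F-0338), `prop_1_4_ii_sync` (F-0365) (the last two by f-076's
`…_of_isFreePro`: `Δ_{U_x} ↠ Δ_X`, `I_x ≤ [F̂₂, F̂₂]⁻`, `F̂₂` free profinite) and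
`CurveModel.oncePuncturedTorus_prop_1_4_package` (presentation ∧ `Δ_X ≠ ⊥` ∧ a section exists ∧ all five).

HONEST LABEL: a group-theoretic model (profinite completions of topological `π₁`'s over an
algebraically closed base: `Π = Δ`, `G_k = 1`), not the étale `π₁` of a scheme (none in the tree);
genus label `1`, no closed points, function fields `:= ℚ̄` and NF-flags `True` by fiat (unused by the
Prop. 1.4 rows).  NON-DEGENERATE in the rows' currency: honest cusp `I_x ≅ Ẑ`, `Δ_{U_x} = F̂₂`,
`Δ_X ≠ 1`, every binder of F-0338/F-0365 fires.  `res` computes by cases on the proof of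
`IsCofiniteOpen` (`obtain ⟨rfl, rfl⟩ := h` first).  Refereed results typed statements-first (D-0014);
typed ≠ proved; an instance form about OUR typed statement ≠ the printed theorem; nothing here bears on
[IUTchIII] Cor. 3.12 or asserts that abc is proved or refuted; no side taken.  No `instance`, no
notation.  Axioms standard.
-/

noncomputable section

open CategoryTheory Topology

namespace Literature.AnabelianGeometry.AbsoluteAnabelian.AbsTopIII

open Literature.IUT.HodgeTheaters (profiniteCompletion toCompletion)

namespace OncePuncturedTorusCarrier

/-- Over an algebraically closed field the absolute Galois group is trivial. [folklore] -/
private theorem subsingleton_absoluteGaloisGroup_of_isAlgClosed (k : Type) [Field k] [IsAlgClosed k] :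
    Subsingleton (Field.absoluteGaloisGroup k) := by
  refine ⟨fun σ τ => AlgEquiv.ext fun x => ?_⟩
  obtain ⟨a, rfl⟩ :=
    (IsAlgClosed.algebraMap_bijective_of_isIntegral (k := k) (K := AlgebraicClosure k)).2 x
  rw [AlgEquiv.commutes, AlgEquiv.commutes]

/-- For an extension whose Galois group is trivial, `Δ = Π`. [folklore] -/
private theorem geom_eq_top_of_subsingleton (E : FundamentalExtension.{0}) [Subsingleton E.gal] :
    E.geom = ⊤ := by
  rw [eq_top_iff]
  intro x _
  rw [FundamentalExtension.mem_geom]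
  exact Subsingleton.elim _ _

/-- `F̂₂ = ⟨a, b⟩^`, profinite completion of the free group on two letters (`Π_{U_x}`). [cite: MochizukiAbsTopIII2015, Prop 1.4 p.31] -/
def freeTwo : ProfiniteGrp.{0} := profiniteCompletion (FreeGroup (Fin 2))

/-- The two letters `a = gens 0`, `b = gens 1` of `F̂₂`. [cite: MochizukiAbsTopIII2015, Prop 1.4 p.31] -/
def gens : Fin 2 → freeTwo := fun i => toCompletion (FreeGroup (Fin 2)) (FreeGroup.of i)

/-- `F̂₂` is free pro-{primes} on `a, b`. [cite: MochizukiAbsTopIII2015, Prop 1.4 p.31] -/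
theorem isFreeProOn_gens : IsFreeProOn freeTwo {p : ℕ | p.Prime} gens :=
  isFreeProOn_profiniteCompletion_freeGroup 2

/-- `{primes}` contains every prime (bookkeeping for the `IsFreeProOn` API). [folklore] -/
private theorem primes_mem : ∀ p : ℕ, p.Prime → p ∈ {p : ℕ | p.Prime} := fun _ hp => hp

/-- The commutator `[a, b]`, generating the inertia group at the puncture. [cite: MochizukiAbsTopIII2015, Prop 1.4 (i) p.31] -/
def comm : freeTwo := gens 0 * gens 1 * (gens 0)⁻¹ * (gens 1)⁻¹

/-- `I_x = ⟨[a, b]⟩⁻`, the closed procyclic inertia group of the cusp. [cite: MochizukiAbsTopIII2015, Prop 1.4 (i) p.31] -/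
def inertia : Subgroup freeTwo := (Subgroup.zpowers comm).topologicalClosure

/-- `N = ⟨⟨I_x⟩⟩⁻ = Ker(Δ_{U_x} ↠ Δ_X)`. [cite: MochizukiAbsTopIII2015, Prop 1.4 (i) p.31] -/
def cuspKernel : Subgroup freeTwo := (Subgroup.normalClosure (inertia : Set freeTwo)).topologicalClosure

/-- `N` is normal. [cite: MochizukiAbsTopIII2015, Prop 1.4 (i) p.31] -/
theorem normal_cuspKernel : cuspKernel.Normal := Subgroup.is_normal_topologicalClosure _

/-- `I_x = ⟨[a, b]⟩⁻ ≅ Ẑ` is free procyclic ("`I_x ≅ Ẑ(1)`"). [cite: MochizukiAbsTopIII2015, Prop 1.4 (i) p.31] -/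
theorem isFreeProcyclic_inertia : FundamentalExtension.IsFreeProcyclic inertia :=
  isFreeProOn_gens.isFreeProcyclic_topologicalClosure_zpowers_commutator primes_mem (by decide)

/-- One puncture: `I_x ≤ [F̂₂, F̂₂]⁻`. [cite: MochizukiAbsTopIII2015, Prop 1.4 (ii) p.31] -/
theorem inertia_le_commutator :
    inertia ≤ (⁅(⊤ : Subgroup freeTwo), (⊤ : Subgroup freeTwo)⁆).topologicalClosure :=
  topologicalClosure_zpowers_commutator_le _ _

/-- The injectivity clause of Prop. 1.4 (ii) here: `⟨[a,b]⟩⁻ ∩ [⟨⟨[a,b]⟩⟩⁻, F̂₂]⁻ = 1`.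
[cite: MochizukiAbsTopIII2015, Prop 1.4 (ii) p.31] -/
theorem inertia_inf_commutator_cuspKernel_eq_bot :
    inertia ⊓ (⁅cuspKernel, (⊤ : Subgroup freeTwo)⁆).topologicalClosure = ⊥ :=
  isFreeProOn_gens.topologicalClosure_zpowers_commutator_inf_eq_bot primes_mem (by decide)

/-- `Π_X = Δ_X = F̂₂ / ⟨⟨[a, b]⟩⟩⁻` (profinite `π₁` of the torus). [cite: MochizukiAbsTopIII2015, Prop 1.4 (ii) p.31] -/
def piX : ProfiniteGrp.{0} :=
  haveI : cuspKernel.Normal := normal_cuspKernel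
  haveI : TotallyDisconnectedSpace (freeTwo ⧸ cuspKernel) :=
    Literature.GroupTheory.ProfiniteSubquotients.totallyDisconnectedSpace_quotient cuspKernel
      (Subgroup.isClosed_topologicalClosure _)
  ProfiniteGrp.of (freeTwo ⧸ cuspKernel)

/-- `F̂₂ ↠ G_{ℚ̄} = 1`, the extension of `U_x` over `ℚ̄` (`Π = Δ`). [cite: MochizukiAbsTopIII2015, Prop 1.4 p.31] -/
abbrev extU : FundamentalExtension.{0} where
  arith := freeTwo
  gal := absoluteGaloisGrp (AlgebraicClosure ℚ)
  aug := 1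
  aug_surjective g := ⟨1, by
    haveI := subsingleton_absoluteGaloisGroup_of_isAlgClosed (AlgebraicClosure ℚ)
    exact Subsingleton.elim _ _⟩

/-- `F̂₂/⟨⟨[a,b]⟩⟩⁻ ↠ G_{ℚ̄} = 1`, the extension of the torus `X` over `ℚ̄`. [cite: MochizukiAbsTopIII2015, Prop 1.4 p.31] -/
abbrev extX : FundamentalExtension.{0} where
  arith := piX
  gal := absoluteGaloisGrp (AlgebraicClosure ℚ)
  aug := 1
  aug_surjective g := ⟨1, by
    haveI := subsingleton_absoluteGaloisGroup_of_isAlgClosed (AlgebraicClosure ℚ)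
    exact Subsingleton.elim _ _⟩

/-- `G_k = 1` for `U_x`. [folklore] -/
private theorem subsingleton_gal_extU : Subsingleton extU.gal :=
  subsingleton_absoluteGaloisGroup_of_isAlgClosed _

/-- `G_k = 1` for `X`. [folklore] -/
private theorem subsingleton_gal_extX : Subsingleton extX.gal :=
  subsingleton_absoluteGaloisGroup_of_isAlgClosed _

/-- The quotient map `F̂₂ ↠ F̂₂/⟨⟨[a,b]⟩⟩⁻`, continuously. [cite: MochizukiAbsTopIII2015, Prop 1.4 (i) p.31] -/
def quotHom : extU.arith →ₜ* extX.arith :=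
  haveI : cuspKernel.Normal := normal_cuspKernel
  { (QuotientGroup.mk' cuspKernel : freeTwo →* freeTwo ⧸ cuspKernel) with
    continuous_toFun := QuotientGroup.continuous_mk }

/-- The cuspidal quotient `Π_{U_x} ↠ Π_X` as a morphism of extensions. [cite: MochizukiAbsTopIII2015, Prop 1.4 (i) p.31] -/
def resHom : extU ⟶ extX :=
  ⟨quotHom, ContinuousMonoidHom.id _, fun _ => by
    haveI := subsingleton_gal_extX
    exact Subsingleton.elim _ _⟩

/-- `Δ_{U_x} = Π_{U_x}`. [cite: MochizukiAbsTopIII2015, Prop 1.4 p.31] -/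
theorem geom_extU_eq_top : extU.geom = (⊤ : Subgroup freeTwo) :=
  haveI := subsingleton_gal_extU
  geom_eq_top_of_subsingleton extU

/-- `Δ_X = Π_X`. [cite: MochizukiAbsTopIII2015, Prop 1.4 p.31] -/
theorem geom_extX_eq_top : extX.geom = (⊤ : Subgroup piX) :=
  haveI := subsingleton_gal_extX
  geom_eq_top_of_subsingleton extX

/-- The cuspidal data of `U_x`: ONE cusp, `D_x = I_x = ⟨[a,b]⟩⁻`. [cite: MochizukiAbsTopIII2015, Prop 1.4 (i) p.31] -/
abbrev cuspsU : extU.CuspidalData where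
  Cusp := PUnit
  Dcusp _ := inertia
  Icusp _ := inertia ⊓ extU.geom
  Icusp_eq _ := rfl
  isClosed_Dcusp _ := Subgroup.isClosed_topologicalClosure _
  eq_of_conj x y _ _ := Subsingleton.elim x y

/-- The cuspidal data of the proper curve `X`: no cusps. [cite: MochizukiAbsTopIII2015, Prop 1.4 p.31] -/
abbrev cuspsX : extX.CuspidalData where
  Cusp := PEmpty
  Dcusp x := x.elim
  Icusp x := x.elim
  Icusp_eq x := x.elim
  isClosed_Dcusp x := x.elim
  eq_of_conj x := x.elim

/-- `I_x = ⟨[a,b]⟩⁻` for the one cusp of `U_x`. [cite: MochizukiAbsTopIII2015, Prop 1.4 (i) p.31] -/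
theorem Icusp_cuspsU (x : cuspsU.Cusp) : cuspsU.Icusp x = inertia := by
  change inertia ⊓ extU.geom = inertia
  rw [geom_extU_eq_top, inf_top_eq]

/-- The one cusp of `U_x` is rational (`G_k = 1`). [cite: MochizukiAbsTopIII2015, Prop 1.4 (ii) p.31] -/
theorem isRational_cuspsU (x : cuspsU.Cusp) : cuspsU.IsRational x := fun g _ =>
  ⟨1, inertia.one_mem, by
    haveI := subsingleton_gal_extU
    exact Subsingleton.elim _ _⟩

/-- **THE ONCE-PUNCTURED-TORUS CARRIER of `CurveModel`**: two curves over `k = ℚ̄` — `U_x` (`⟨true⟩`,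
`extU`, one cusp) and its compactification `X` (`⟨false⟩`, `extX`, proper, no cusps) —, `U_x ⊆ X` the
only cofinite open, `res :=` the quotient map; genus label `1`; no closed points; function fields `:= ℚ̄`,
NF-flags by fiat.  A group-theoretic model, not an étale `π₁`. [cite: MochizukiAbsTopIII2015, Prop 1.4 p.31] -/
def model : CurveModel.{0} where
  Curve := ULift.{1} Bool
  base _ := AlgebraicClosure ℚ
  ext U := cond U.down extU extX
  galIso U := by
    rcases U with ⟨_ | _⟩ <;> exact Iso.refl _
  cusps U := by
    rcases U with ⟨_ | _⟩
    exacts [cuspsX, cuspsU]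
  IsProper U := U = ⟨false⟩
  IsScheme _ := True
  genus _ := 1
  FunctionField _ := AlgebraicClosure ℚ
  Point _ := PEmpty
  decomp _ x := x.elim
  IsNFCurve _ := True
  IsNFPoint _ x := x.elim
  IsNFRational _ _ := True
  IsNFConstant _ _ := True
  NFFunctionField _ := AlgebraicClosure ℚ
  IsStrictlyBelyiType _ := False
  IsCofiniteOpen U U' := U = ⟨true⟩ ∧ U' = ⟨false⟩
  res {U U'} h := by
    obtain ⟨rfl, rfl⟩ := h
    exact resHom

/-- The cuspidal kernel of `res` is `N = ⟨⟨I_x⟩⟩⁻`. [cite: MochizukiAbsTopIII2015, Prop 1.4 (i) p.31] -/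
theorem cuspidalKernel_resHom (x : cuspsU.Cusp) :
    cuspidalKernel resHom = (Subgroup.normalClosure (cuspsU.Icusp x : Set freeTwo)).topologicalClosure := by
  haveI : cuspKernel.Normal := normal_cuspKernel
  rw [Icusp_cuspsU]
  change quotHom.toMonoidHom.ker ⊓ extU.geom = cuspKernel
  rw [geom_extU_eq_top, inf_top_eq]
  exact QuotientGroup.ker_mk' cuspKernel

/-- **`(U_x ⊆ X, x)` is a cyclotome presentation** of the carrier: scheme-like, `X` proper, `x` rational,
`I_x ≅ Ẑ`, cuspidal kernel `= ⟨⟨I_x⟩⟩⁻`, `1 → I_x → Δ^{c-cn}_{U_x} → Δ_X → 1` exact (abc-iut's reduction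
`isCuspidallyCentralExtension_iff_inf_eq_bot`). [cite: MochizukiAbsTopIII2015, Prop 1.4 (ii) p.31] -/
theorem isCyclotomePresentation (x : (model.cusps ⟨true⟩).Cusp) :
    model.IsCyclotomePresentation (Ux := ⟨true⟩) (X := ⟨false⟩) ⟨rfl, rfl⟩ x := by
  have hker := cuspidalKernel_resHom x
  refine
    { isScheme := ⟨trivial, trivial⟩
      isProper := rfl
      isRational := isRational_cuspsU x
      isFreeProcyclic := by
        change FundamentalExtension.IsFreeProcyclic (cuspsU.Icusp x)
        rw [Icusp_cuspsU]
        exact isFreeProcyclic_inertia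
      kernel_eq := hker
      isCuspidallyCentral := ?_ }
  change IsCuspidallyCentralExtension resHom (cuspsU.Icusp x)
  rw [isCuspidallyCentralExtension_iff_inf_eq_bot resHom cuspsU x (isRational_cuspsU x) hker]
  unfold cuspidallyCentralModulus
  rw [hker, Icusp_cuspsU, geom_extU_eq_top]
  exact inertia_inf_commutator_cuspKernel_eq_bot

/-- At every cyclotome presentation of the carrier, `Δ_{U_x} ↠ Δ_X`. [cite: MochizukiAbsTopIII2015, Prop 1.4 (ii) p.32] -/
theorem surjOn_res (Ux X : model.Curve) (h : model.IsCofiniteOpen Ux X) (x : (model.cusps Ux).Cusp)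
    (_hp : model.IsCyclotomePresentation h x) :
    Set.SurjOn (model.res h).arith (model.ext Ux).geom (model.ext X).geom := by
  haveI : cuspKernel.Normal := normal_cuspKernel
  obtain ⟨rfl, rfl⟩ := h
  change Set.SurjOn quotHom extU.geom extX.geom
  rw [geom_extU_eq_top, geom_extX_eq_top]
  rintro y -
  obtain ⟨g, rfl⟩ := QuotientGroup.mk_surjective (s := cuspKernel) y
  exact ⟨g, Subgroup.mem_top g, rfl⟩

/-- At every cyclotome presentation, `I_x ≤ [Δ_{U_x}, Δ_{U_x}]⁻`. [cite: MochizukiAbsTopIII2015, Prop 1.4 (ii) p.31] -/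
theorem Icusp_le_commutator (Ux X : model.Curve) (h : model.IsCofiniteOpen Ux X)
    (x : (model.cusps Ux).Cusp) (_hp : model.IsCyclotomePresentation h x) :
    (model.cusps Ux).Icusp x ≤ (⁅(model.ext Ux).geom, (model.ext Ux).geom⁆).topologicalClosure := by
  obtain ⟨rfl, rfl⟩ := h
  change cuspsU.Icusp x ≤ (⁅extU.geom, extU.geom⁆).topologicalClosure
  rw [Icusp_cuspsU, geom_extU_eq_top]
  exact inertia_le_commutator

/-- At every cyclotome presentation, `Δ_{U_x} = F̂₂` is free profinite. [cite: MochizukiAbsTopIII2015, Prop 1.4 (ii) p.31] -/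
theorem isFreePro_geom (Ux X : model.Curve) (h : model.IsCofiniteOpen Ux X) (x : (model.cusps Ux).Cusp)
    (_hp : model.IsCyclotomePresentation h x) : IsFreePro (model.ext Ux).geom {p : ℕ | p.Prime} := by
  obtain ⟨rfl, rfl⟩ := h
  change IsFreePro extU.geom {p : ℕ | p.Prime}
  rw [geom_extU_eq_top]
  let e : freeTwo ≃ₜ* (⊤ : Subgroup freeTwo) :=
    { Subgroup.topEquiv.symm with
      continuous_toFun := Continuous.subtype_mk continuous_id _
      continuous_invFun := continuous_subtype_val }
  exact ⟨2, _, isFreeProOn_gens.of_continuousMulEquiv e⟩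

/-- **`Δ_X ≠ 1`**: the character `F̂₂ → ℤ/2`, `a ↦ 1`, `b ↦ 0` kills `⟨⟨[a,b]⟩⟩⁻`, not `a`. [cite: MochizukiAbsTopIII2015, Prop 1.4 (ii) p.31] -/
theorem geom_extX_ne_bot : extX.geom ≠ ⊥ := by
  haveI : cuspKernel.Normal := normal_cuspKernel
  rw [geom_extX_eq_top]
  intro htop
  have ha : (QuotientGroup.mk (gens 0) : freeTwo ⧸ cuspKernel) = 1 :=
    (Subgroup.eq_bot_iff_forall _).mp htop (QuotientGroup.mk (gens 0)) (Subgroup.mem_top _)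
  rw [QuotientGroup.eq_one_iff] at ha
  letI : TopologicalSpace (Multiplicative (ZMod 2)) := ⊥
  haveI : DiscreteTopology (Multiplicative (ZMod 2)) := ⟨rfl⟩
  obtain ⟨χ, hχc, hχa, hχb⟩ := isFreeProOn_gens.exists_continuous_hom_pair primes_mem
    (show (0 : Fin 2) ≠ 1 by decide) (Multiplicative (ZMod 2)) (Multiplicative.ofAdd 1) 1
  have hcl : IsClosed (χ.ker : Set freeTwo) := by
    rw [MonoidHom.coe_ker]
    exact (isClosed_discrete _).preimage hχc
  have hχI : inertia ≤ χ.ker := by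
    have h1 : inertia ≤ χ.ker.topologicalClosure := by
      refine Subgroup.topologicalClosure_mono ?_
      rw [Subgroup.zpowers_le, MonoidHom.mem_ker]
      simp only [comm, map_mul, map_inv, hχa, hχb, mul_one, inv_one, mul_inv_cancel]
    rwa [le_antisymm (Subgroup.topologicalClosure_minimal _ le_rfl hcl)
      (Subgroup.le_topologicalClosure _)] at h1
  have := Subgroup.topologicalClosure_minimal _ (Subgroup.normalClosure_le_normal hχI) hcl ha
  rw [MonoidHom.mem_ker, hχa] at this
  exact absurd this (by decide)

/-- **F-0339 at the carrier**: every cuspidal inertia group is free procyclic. [cite: MochizukiAbsTopIII2015, Prop 1.4 (i) p.31] -/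
theorem prop_1_4_i : model.Prop_1_4_i := by
  rintro ⟨_ | _⟩ _ x
  · exact x.elim
  · change FundamentalExtension.IsFreeProcyclic (cuspsU.Icusp x)
    rw [Icusp_cuspsU]
    exact isFreeProcyclic_inertia

/-- **F-0340 at the carrier**: `res` surjective, Galois part bijective, kernel `⟨⟨I_x⟩⟩⁻`. [cite: MochizukiAbsTopIII2015, Prop 1.4 (i) p.31] -/
theorem prop_1_4_i' : model.Prop_1_4_i' := by
  haveI : cuspKernel.Normal := normal_cuspKernel
  intro U U' h _ _
  obtain ⟨rfl, rfl⟩ := h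
  change Function.Surjective quotHom ∧
    Function.Bijective (ContinuousMonoidHom.id (absoluteGaloisGrp (AlgebraicClosure ℚ))) ∧
      ∃ S : Set cuspsU.Cusp, quotHom.toMonoidHom.ker =
        (Subgroup.normalClosure (⋃ c ∈ S, (cuspsU.Icusp c : Set freeTwo))).topologicalClosure
  refine ⟨QuotientGroup.mk'_surjective cuspKernel, Function.bijective_id, Set.univ, ?_⟩
  have hU : (⋃ c ∈ (Set.univ : Set cuspsU.Cusp), (cuspsU.Icusp c : Set freeTwo)) = (inertia : Set freeTwo) := by
    ext g
    simp only [Set.mem_iUnion, Set.mem_univ, SetLike.mem_coe, exists_const, Subgroup.mem_inf,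
      geom_extU_eq_top, Subgroup.mem_top, and_true]
  rw [hU]
  exact QuotientGroup.ker_mk' cuspKernel

/-- **F-0341 at the carrier**: `1 → I_x → Δ^{c-cn}_{U_x} → Δ_X → 1` is exact. [cite: MochizukiAbsTopIII2015, Prop 1.4 (ii) p.31] -/
theorem prop_1_4_ii : model.Prop_1_4_ii := by
  rw [CurveModel.prop_1_4_ii_iff_inf_eq_bot]
  intro Ux X h _ _ _ x hx hker
  obtain ⟨rfl, rfl⟩ := h
  change cuspsU.Icusp x ⊓ cuspidallyCentralModulus resHom = ⊥
  change cuspidalKernel resHom =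
    (Subgroup.normalClosure (cuspsU.Icusp x : Set freeTwo)).topologicalClosure at hker
  unfold cuspidallyCentralModulus
  rw [hker, Icusp_cuspsU, geom_extU_eq_top]
  exact inertia_inf_commutator_cuspKernel_eq_bot

/-- **F-0338 at the carrier** (f-076's `prop_1_4_ii_transgression_of_isFreePro`): the differential
`Hom_cont(Ker(Δ^{c-cn}_{U_x} ↠ Δ_X), Ẑ) → H²(Δ_X, Ẑ)` is bijective at every cyclotome presentation and section.
[cite: MochizukiAbsTopIII2015, Prop 1.4 (ii) p.31] -/
theorem prop_1_4_ii_transgression : model.Prop_1_4_ii_transgression :=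
  model.prop_1_4_ii_transgression_of_isFreePro primes_mem surjOn_res Icusp_le_commutator isFreePro_geom

/-- **F-0365 at the carrier** (f-076 / f-082's `prop_1_4_ii_sync_of_isFreePro`): a `Π_{U_x}`-equivariant
identification `M_X = Hom(H²(Δ_X, Ẑ), Ẑ) ≅ I_x` exists at every cyclotome presentation.
[cite: MochizukiAbsTopIII2015, Prop 1.4 (ii) p.31] -/
theorem prop_1_4_ii_sync : model.Prop_1_4_ii_sync :=
  model.prop_1_4_ii_sync_of_isFreePro primes_mem surjOn_res Icusp_le_commutator isFreePro_geom

end OncePuncturedTorusCarrier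

namespace CurveModel

open OncePuncturedTorusCarrier

/-- **The Prop. 1.4 package at the named carrier, next to the binders that fire**: `(U_x ⊆ X, x)` IS a
cyclotome presentation (the `∀`-binders of F-0338/F-0365 are met), `Δ_X ≠ 1`, a continuous section of
`Δ^{c-cn}_{U_x} ↠ Δ_X` exists (the section binder of F-0338 is inhabited), and all five rows hold.
[cite: MochizukiAbsTopIII2015, Prop 1.4 p.31] -/
theorem oncePuncturedTorus_prop_1_4_package :
    OncePuncturedTorusCarrier.model.IsCyclotomePresentation (Ux := ⟨true⟩) (X := ⟨false⟩) ⟨rfl, rfl⟩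
        PUnit.unit ∧
      (OncePuncturedTorusCarrier.model.ext ⟨false⟩).geom ≠ ⊥ ∧
      Nonempty (CcnSection (OncePuncturedTorusCarrier.model.res (U := ⟨true⟩) (U' := ⟨false⟩) ⟨rfl, rfl⟩)) ∧
      OncePuncturedTorusCarrier.model.Prop_1_4_i ∧ OncePuncturedTorusCarrier.model.Prop_1_4_i' ∧
      OncePuncturedTorusCarrier.model.Prop_1_4_ii ∧
      OncePuncturedTorusCarrier.model.Prop_1_4_ii_transgression ∧
      OncePuncturedTorusCarrier.model.Prop_1_4_ii_sync :=
  ⟨isCyclotomePresentation PUnit.unit, geom_extX_ne_bot,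
    nonempty_ccnSection _ (surjOn_res ⟨true⟩ ⟨false⟩ ⟨rfl, rfl⟩ PUnit.unit
      (isCyclotomePresentation PUnit.unit)),
    OncePuncturedTorusCarrier.prop_1_4_i, OncePuncturedTorusCarrier.prop_1_4_i',
    OncePuncturedTorusCarrier.prop_1_4_ii, OncePuncturedTorusCarrier.prop_1_4_ii_transgression,
    OncePuncturedTorusCarrier.prop_1_4_ii_sync⟩

end CurveModel

end Literature.AnabelianGeometry.AbsoluteAnabelian.AbsTopIII

end
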